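import Summits.ResolutionOfSingularities.ResolutionOfSingularities.Theorems.WeightedInvariantIota3DropTypeA
import Summits.ResolutionOfSingularities.ResolutionOfSingularities.Theorems.WeightedInvariantIota3TauDescentBaseTwoAssembly
import Summits.ResolutionOfSingularities.ResolutionOfSingularities.Theorems.WeightedInvariantHypersurfaceCentreAssemblyTorusStalk
import HarnessLib

/-!
# (DROP)₃, (D-div) CORE: over a PRINCIPAL centre `(π)` carrying `f = v·π^ν` (`v` a unit) the cobordant blow-up has NO singular
# successor off the vertex (door `HypersurfaceCentreConstruction`, stmt-ResolutionOfSingularities-19897)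

Helper for `stub_keyRungGrHomLE_three` (def-free, `--supports 19897`).  Sequel of …Iota3DropTypeA ((DROP)₃ = TYPE (a) ✓ + (D-b) + (D-div)).
The ring-theoretic heart of the divisor-centre case (D-div): `S` a domain, `(u, w)` a weighted family whose pieces
`𝒥ₘ = weightedMonomialIdeal u w m` lie inside `(π^m)` with `π ∈ 𝒥₁`, and `f = v·π^ν` with `v` a unit, `f ∈ 𝒥_ν ∖ 𝒥_{ν+1}`.  Then in
`B = cobordantAlgebra' u w = S[t⁻¹, 𝒥ₘ tᵐ]`: the vertex ideal is contained in `(π t)`, `f = (t⁻¹)^ν · (v (π t)^ν)` is THE `t⁻¹`-primitive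
factorisation, and so every successor prime `𝔫 ∌` vertex, `∋ t⁻¹`, misses the transform `g`:
**`DivCentre.transform_not_mem_of_principal`** (`g ∉ 𝔫`), **`DivCentre.transform_not_mem_maximalIdeal_sq`** (`g/1 ∉ 𝔪_{B_𝔫}²`), and the
vacuous drop **`DivCentre.weightedDrop_of_principal`** (`WeightedDrop ι S f P u w` for EVERY `ι`, every `P`).
What remains of (D-div) is the `S`-side derivation at a door position with `ht P = 1` (PRES3.md §4): `P = (π)`, `𝒥ₘ = (π^m)`, `f = v π^ν`.
[OURS · L1 W4.3 · commutative algebra; AI work, weaker than expert review; nothing here is a statement of the manuscript under review.]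

## References

* J. Włodarczyk, *Functorial resolution by torus actions*, arXiv:2203.03090, §2.2, Def. 2.3.5, §3.3 (extended Rees algebra, vertex,
  transforms). [Wlodarczyk2022]
-/

noncomputable section

set_option linter.dupNamespace false -- mandated namespace of this single-conjunct summit

open IsLocalRing Literature.AlgebraicGeometry.Resolution LaurentPolynomial
open scoped LaurentPolynomial
open Summit.ResolutionOfSingularities.ResolutionOfSingularities.Theorems

namespace Summit.ResolutionOfSingularities.ResolutionOfSingularities.Cruxes.HypersurfaceCentreConstruction.LocalEngine

namespace DivCentre

variable {S : Type} [CommRing S] {n : ℕ} (u : Fin n → S) (w : Fin n → ℕ)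

/-- The chart element `π t ∈ B = S[t⁻¹, 𝒥ₘ tᵐ]` of a member `π ∈ 𝒥₁`. [cite: Wlodarczyk2022, §2.2] -/
theorem C_mul_T_one_mem {π : S} (hπ : π ∈ weightedMonomialIdeal u w 1) :
    C π * T (1 : ℤ) ∈ extReesAlgebra (weightedMonomialIdeal u w) := by
  have h := extReesAlgebra.C_mul_T_mem (weightedMonomialIdeal u w) Nat.one_pos hπ
  simpa using h

/-- **The vertex ideal lies inside `(π t)`** when every piece `𝒥ₘ` is divisible by `π^m`: a generator `a tᵐ` (`a ∈ 𝒥ₘ`, `a = π^m b`) is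
`b · (π t)^m`. [cite: Wlodarczyk2022, Def. 2.3.5] -/
theorem vertexIdeal_le_span_of_dvd {π : S} (hπ : π ∈ weightedMonomialIdeal u w 1)
    (hI : ∀ (m : ℕ) (a : S), a ∈ weightedMonomialIdeal u w m → π ^ m ∣ a) :
    extReesAlgebra.vertexIdeal (weightedMonomialIdeal u w) ≤
      Ideal.span {(⟨C π * T (1 : ℤ), C_mul_T_one_mem u w hπ⟩ : cobordantAlgebra' u w)} := by
  unfold extReesAlgebra.vertexIdeal
  rw [Ideal.span_le]
  rintro x ⟨m, hm, a, ha, hx⟩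
  obtain ⟨b, rfl⟩ := hI m a ha
  rw [SetLike.mem_coe, Ideal.mem_span_singleton]
  refine ⟨algebraMap S (cobordantAlgebra' u w) b *
    (⟨C π * T (1 : ℤ), C_mul_T_one_mem u w hπ⟩ : cobordantAlgebra' u w) ^ (m - 1), Subtype.ext ?_⟩
  obtain ⟨k, rfl⟩ := Nat.exists_eq_succ_of_ne_zero hm.ne'
  simp only [Nat.succ_sub_one, Subalgebra.coe_mul, Subalgebra.coe_pow, Subalgebra.coe_algebraMap, hx]
  rw [mul_pow, T_pow, map_mul, map_pow, ← C_eq_algebraMap]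
  have hT : (T ((k.succ : ℕ) : ℤ) : S[T;T⁻¹]) = T (1 : ℤ) * T ((k : ℕ) * 1 : ℤ) := by
    rw [← T_add]; congr 1; push_cast; ring
  rw [hT]
  simp only [Nat.succ_eq_add_one, pow_succ]
  ring

/-- **THE TRANSFORM OF `f = v π^ν` MISSES EVERY SUCCESSOR PRIME OFF THE VERTEX.**  `S` a domain; pieces `𝒥ₘ ⊆ (π^m)`, `π ∈ 𝒥₁`; `v` a unit,
`0 < ν`, `v π^ν ∈ 𝒥_ν ∖ 𝒥_{ν+1}`; `𝔫` a prime of `B = cobordantAlgebra' u w` with `𝔫 ⊉` vertex (`t⁻¹ ∈ 𝔫` is not even needed); `v π^ν = (t⁻¹)ᵃ g` in `B`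
with `t⁻¹ ∤ g`.  Then `g ∉ 𝔫`.  (The vertex lies in `(π t)`, so `π t ∉ 𝔫`; `v π^ν = (t⁻¹)^ν · v (π t)^ν` with `t⁻¹ ∤ v (π t)^ν`; in the
domain `B` the `t⁻¹`-primitive factorisation is unique, so `g = v (π t)^ν ∉ 𝔫`.) [cite: Wlodarczyk2022, §3.3] -/
theorem transform_not_mem_of_principal [IsDomain S] {π v : S} (hv : IsUnit v) {ν : ℕ} (hν : 0 < ν)
    (hπ : π ∈ weightedMonomialIdeal u w 1)
    (hI : ∀ (m : ℕ) (a : S), a ∈ weightedMonomialIdeal u w m → π ^ m ∣ a)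
    (hfν : v * π ^ ν ∈ weightedMonomialIdeal u w ν) (hf1 : v * π ^ ν ∉ weightedMonomialIdeal u w (ν + 1))
    (𝔫 : Ideal (cobordantAlgebra' u w)) [𝔫.IsPrime]
    (hV : ¬ extReesAlgebra.vertexIdeal (weightedMonomialIdeal u w) ≤ 𝔫)
    (a : ℕ) (g : cobordantAlgebra' u w) (hfg : algebraMap S (cobordantAlgebra' u w) (v * π ^ ν) = cobordantT' u w ^ a * g)
    (hTg : ¬ cobordantT' u w ∣ g) : g ∉ 𝔫 := by
  haveI : IsDomain (cobordantAlgebra' u w) := inferInstance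
  set X : cobordantAlgebra' u w := ⟨C π * T (1 : ℤ), C_mul_T_one_mem u w hπ⟩ with hXdef
  -- `π t ∉ 𝔫`
  have hXn : X ∉ 𝔫 := fun hX => hV ((vertexIdeal_le_span_of_dvd u w hπ hI).trans
    ((Ideal.span_singleton_le_iff_mem _).mpr hX))
  -- the transform `G = f t^ν = v (π t)^ν`, `t⁻¹ ∤ G`
  obtain ⟨G, hGcoe, hfG, hGdvd⟩ := Iota3.exists_transform_of_mem S u w hν hfν
  have hTG : ¬ cobordantT' u w ∣ G := fun h => hf1 (hGdvd h)
  have hGeq : G = algebraMap S (cobordantAlgebra' u w) v * X ^ ν := by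
    apply Subtype.ext
    rw [hGcoe, Subalgebra.coe_mul, Subalgebra.coe_pow, Subalgebra.coe_algebraMap, hXdef, ← C_eq_algebraMap, mul_pow, T_pow,
      map_mul, map_pow]
    have hT : (T ((ν : ℕ) : ℤ) : S[T;T⁻¹]) = T ((ν : ℕ) * 1 : ℤ) := by congr 1; ring
    rw [hT]
    ring
  have hGn : G ∉ 𝔫 := by
    rw [hGeq]
    intro hmem
    rcases (‹𝔫.IsPrime›.mem_or_mem hmem) with h1 | h2
    · exact ‹𝔫.IsPrime›.ne_top (Ideal.eq_top_of_isUnit_mem _ h1 (hv.map _))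
    · exact hXn (‹𝔫.IsPrime›.mem_of_pow_mem _ h2)
  -- uniqueness of the `t⁻¹`-primitive factorisation in the domain `B`
  have hT0 : cobordantT' u w ≠ 0 := fun h => by
    have h' : (T (-1) : S[T;T⁻¹]) = 0 := by
      have := congrArg Subtype.val h
      simpa using this
    exact (isUnit_T (R := S) (-1)).ne_zero h'
  have key : cobordantT' u w ^ a * g = cobordantT' u w ^ ν * G := hfg.symm.trans hfG
  rcases lt_trichotomy a ν with hlt | heq | hgt
  · -- `a < ν`: `g = t⁻¹^(ν-a) G` is divisible by `t⁻¹`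
    exfalso
    obtain ⟨d, rfl⟩ := Nat.exists_eq_add_of_lt hlt
    have h1 : cobordantT' u w ^ a * g = cobordantT' u w ^ a * (cobordantT' u w ^ (d + 1) * G) := by
      rw [key, ← mul_assoc, ← pow_add, add_assoc]
    have h2 : g = cobordantT' u w ^ (d + 1) * G := mul_left_cancel₀ (pow_ne_zero _ hT0) h1
    exact hTg ⟨cobordantT' u w ^ d * G, by rw [h2]; ring⟩
  · subst heq
    have h2 : g = G := mul_left_cancel₀ (pow_ne_zero _ hT0) key
    rw [h2]
    exact hGn
  · -- `a > ν`: `G = t⁻¹^(a-ν) g` is divisible by `t⁻¹`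
    exfalso
    obtain ⟨d, rfl⟩ := Nat.exists_eq_add_of_lt hgt
    have h1 : cobordantT' u w ^ ν * G = cobordantT' u w ^ ν * (cobordantT' u w ^ (d + 1) * g) := by
      rw [← key, ← mul_assoc, ← pow_add, add_assoc]
    have h2 : G = cobordantT' u w ^ (d + 1) * g := mul_left_cancel₀ (pow_ne_zero _ hT0) h1
    exact hTG ⟨cobordantT' u w ^ d * g, by rw [h2]; ring⟩

/-- **Hence the transform is a unit at every successor off the vertex: `g/1 ∉ 𝔪_{B_𝔫}²`** (indeed `∉ 𝔪_{B_𝔫}`).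
[cite: Wlodarczyk2022, §3.3] -/
theorem transform_not_mem_maximalIdeal_sq [IsDomain S] {π v : S} (hv : IsUnit v) {ν : ℕ} (hν : 0 < ν)
    (hπ : π ∈ weightedMonomialIdeal u w 1)
    (hI : ∀ (m : ℕ) (a : S), a ∈ weightedMonomialIdeal u w m → π ^ m ∣ a)
    (hfν : v * π ^ ν ∈ weightedMonomialIdeal u w ν) (hf1 : v * π ^ ν ∉ weightedMonomialIdeal u w (ν + 1))
    (𝔫 : Ideal (cobordantAlgebra' u w)) [𝔫.IsPrime]
    (hV : ¬ extReesAlgebra.vertexIdeal (weightedMonomialIdeal u w) ≤ 𝔫)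
    (a : ℕ) (g : cobordantAlgebra' u w) (hfg : algebraMap S (cobordantAlgebra' u w) (v * π ^ ν) = cobordantT' u w ^ a * g)
    (hTg : ¬ cobordantT' u w ∣ g) :
    algebraMap (cobordantAlgebra' u w) (Localization.AtPrime 𝔫) g ∉ maximalIdeal (Localization.AtPrime 𝔫) ^ 2 := by
  intro hmem
  have h1 : algebraMap (cobordantAlgebra' u w) (Localization.AtPrime 𝔫) g ∈ maximalIdeal (Localization.AtPrime 𝔫) :=
    Ideal.pow_le_self two_ne_zero hmem
  have h2 : g ∈ 𝔫 := by
    have := (IsLocalization.AtPrime.to_map_mem_maximal_iff (Localization.AtPrime 𝔫) 𝔫 g).mp h1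
    exact this
  exact transform_not_mem_of_principal u w hv hν hπ hI hfν hf1 𝔫 hV a g hfg hTg h2

/-- **THE VACUOUS DROP OVER A PRINCIPAL CENTRE**: under the hypotheses of `transform_not_mem_of_principal`, for EVERY invariant `ι` and
every ideal `P`, `WeightedDrop ι S (v π^ν) P u w` (no successor off the vertex satisfies `g/1 ∈ 𝔪_𝔫²`); in particular
`WeightedDropHom ι S (v π^ν) P u w` (`WeightedDrop.toHom`). [OURS · L1 W4.3 · (D-div) core] -/
theorem weightedDrop_of_principal [IsDomain S] (ι : (R : Type) → [CommRing R] → R → Ordinal.{0}) {π v : S} (hv : IsUnit v)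
    {ν : ℕ} (hν : 0 < ν) (hπ : π ∈ weightedMonomialIdeal u w 1)
    (hI : ∀ (m : ℕ) (a : S), a ∈ weightedMonomialIdeal u w m → π ^ m ∣ a)
    (hfν : v * π ^ ν ∈ weightedMonomialIdeal u w ν) (hf1 : v * π ^ ν ∉ weightedMonomialIdeal u w (ν + 1)) (P : Ideal S) :
    WeightedDrop ι S (v * π ^ ν) P u w :=
  fun 𝔫 _ _ _ hV a g hfg hTg hg2 =>
    absurd hg2 (transform_not_mem_maximalIdeal_sq u w hv hν hπ hI hfν hf1 𝔫 hV a g hfg hTg)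

end DivCentre

end Summit.ResolutionOfSingularities.ResolutionOfSingularities.Cruxes.HypersurfaceCentreConstruction.LocalEngine

end
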